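import Literature.NumberTheory.EllipticCurves.HeegnerPoints
import Literature.NumberTheory.QuadraticFields.ClassNumberOne
import Mathlib.NumberTheory.NumberField.Cyclotomic.Embeddings
import Mathlib.NumberTheory.NumberField.Units.DirichletTheorem
import Mathlib.NumberTheory.NumberField.CMField
import Mathlib.NumberTheory.NumberField.Discriminant.Basic
import HarnessLib

/-!
# `Literature.NumberTheory.EllipticCurves.IsImaginaryQuadratic`: basic API, witnesses, and why it has no `_holds`

Sibling proof file of `Literature.NumberTheory.EllipticCurves.HeegnerPoints` for the predicate
`Literature.IsImaginaryQuadratic K := Module.finrank ℚ K = 2 ∧ NumberField.IsTotallyComplex K`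
("`K` is an imaginary quadratic field", the standing hypothesis on `K` of Gross, *Heegner points
on `X₀(N)`* (1984), §1, which the definition cites; for the notion in print see Cox, *Primes of
the form `x² + ny²`*, 2nd ed. (2013), §5.B, p. 119: "Quadratic fields come in two flavors, real
(`d_K > 0`) and imaginary (`d_K < 0`) … In the imaginary case, there are only finitely many
units" — for `[K : ℚ] = 2`, `d_K < 0` iff `K` has no real place, the form used by the definition).

`IsImaginaryQuadratic` is a *definition* (a predicate on number fields, its binders `K`,
`[Field K]`, `[NumberField K]` coming from a `variable` line), used as the hypothesis
`(hK : IsImaginaryQuadratic K)` of the Heegner-point facts; it is **not** a closed named fact: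
its universal closure is false (`Literature.NumberTheory.EllipticCurves.not_isImaginaryQuadratic_rat`: `[ℚ : ℚ] = 1`), so no
`theorem IsImaginaryQuadratic_holds` can exist (`Literature.NumberTheory.EllipticCurves.not_forall_isImaginaryQuadratic`). This file
records that formally and supplies the elementary API provers of the dependent facts need:

* repackaging: `isImaginaryQuadratic_iff_isQuadraticExtension` (Mathlib
  `Algebra.IsQuadraticExtension ℚ K`; the definition itself unfolds by `Iff.rfl`, and its two
  conjuncts are `IsImaginaryQuadratic.finrank_eq_two`, `IsImaginaryQuadratic.isTotallyComplex`);
* agreement with the printed definition: `IsImaginaryQuadratic K ↔ [K : ℚ] = 2 ∧ d_K < 0`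
  (`isImaginaryQuadratic_iff_discr_neg`, Cox loc. cit., via Mathlib `NumberField.sign_discr`:
  `sign d_K = (-1) ^ r₂`) and the real/imaginary dichotomy of quadratic fields
  (`isImaginaryQuadratic_xor_discr_pos`);
* consequences: `d_K < 0` (`IsImaginaryQuadratic.discr_neg`), no real place, exactly one complex
  place, one infinite place (`IsImaginaryQuadratic.nrRealPlaces_eq_zero`, `nrComplexPlaces_eq_one`,
  `card_infinitePlace_eq_one`), unit rank `r₁ + r₂ - 1 = 0` (`unitsRank_eq_zero`), hence every
  unit is a root of unity and `𝓞_K^×` is finite (`mem_torsion`, `finite_units`; Cox loc. cit.,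
  via Mathlib's Dirichlet unit theorem `NumberField.Units.exist_unique_eq_mul_prod`), and `K` is
  a CM field in Mathlib's sense (`IsImaginaryQuadratic.isCMField`,
  `isImaginaryQuadratic_iff_isCMField`, via `NumberField.IsCMField.ofCMExtension ℚ K`), which
  makes `NumberField.complexConj K` available to the Heegner-point files;
* witnesses (non-vacuity): a quadratic field generated by a root of `X² + uX + v`, `u² - 4v < 0`
  (`IsImaginaryQuadratic.of_quadratic`, from `Literature.NumberTheory.QuadraticFields.Quadratic.isTotallyComplex_of_quadratic`), in
  particular by `√c`, `c < 0` (`of_sq_eq`); the cyclotomic fields `ℚ(ζₙ)` with `φ(n) = 2`,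
  i.e. `n = 3, 4, 6` (`of_isCyclotomicExtension`, `…_three`, `…_four`, `…_six`, from Mathlib
  `IsCyclotomicExtension.finrank` and `IsCyclotomicExtension.Rat.isTotallyComplex`), and the
  concrete model `CyclotomicField 3 ℚ = ℚ(√-3)` (`isImaginaryQuadratic_cyclotomicField_three`).

Everything here is proved (no named facts). Mathlib search: `NumberField.IsTotallyComplex`,
`nrRealPlaces_eq_zero_iff`, `IsTotallyComplex.finrank`, `card_eq_nrRealPlaces_add_nrComplexPlaces`,
`card_add_two_mul_card_eq_rank`, `NumberField.sign_discr`, `NumberField.discr_ne_zero`,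
`NumberField.Units.rank`, `exist_unique_eq_mul_prod`, `IsCyclotomicExtension.Rat.isTotallyComplex`,
`NumberField.IsCMField.ofCMExtension` exist and are used; Mathlib has no predicate singling out the
imaginary quadratic fields (searched `ImaginaryQuadratic`: nothing; `IsCMField` is the general
notion of CM field, of which `IsImaginaryQuadratic` is the degree-`2` case,
`isImaginaryQuadratic_iff_isCMField`).

## References

* B. H. Gross, *Heegner points on `X₀(N)`*, in *Modular forms (Durham, 1983)*, Horwood (1984),
  87–105, §1.
* D. A. Cox, *Primes of the form `x² + ny²`*, 2nd ed., Wiley (2013), §5.B, p. 119 (real and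
  imaginary quadratic fields; finiteness of units in the imaginary case).
-/

noncomputable section

open scoped Classical

open NumberField NumberField.InfinitePlace Module

universe u

namespace Literature.NumberTheory.EllipticCurves

section API

variable {K : Type u} [Field K] [NumberField K]

/-- `IsImaginaryQuadratic K` in terms of Mathlib's `Algebra.IsQuadraticExtension ℚ K`
(`[K : ℚ] = 2`, freeness being automatic over a field) and `NumberField.IsTotallyComplex K`.
[folklore] -/
theorem isImaginaryQuadratic_iff_isQuadraticExtension :
    IsImaginaryQuadratic K ↔ Algebra.IsQuadraticExtension ℚ K ∧ IsTotallyComplex K := by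
  constructor
  · rintro ⟨h2, hc⟩
    exact ⟨{ finrank_eq_two' := h2 }, hc⟩
  · rintro ⟨h2, hc⟩
    exact ⟨Algebra.IsQuadraticExtension.finrank_eq_two ℚ K, hc⟩

namespace IsImaginaryQuadratic

/-- An imaginary quadratic field has degree `2` over `ℚ`. [cite: Gross1984, §1] -/
theorem finrank_eq_two (hK : IsImaginaryQuadratic K) : finrank ℚ K = 2 :=
  hK.1

/-- An imaginary quadratic field is totally complex. [cite: Gross1984, §1] -/
theorem isTotallyComplex (hK : IsImaginaryQuadratic K) : IsTotallyComplex K :=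
  hK.2

/-- An imaginary quadratic field has no real place (`r₁ = 0`). [folklore] -/
theorem nrRealPlaces_eq_zero (hK : IsImaginaryQuadratic K) : nrRealPlaces K = 0 :=
  (nrRealPlaces_eq_zero_iff (K := K)).mpr hK.2

/-- An imaginary quadratic field has exactly one complex place (`r₂ = 1`, as `2 = r₁ + 2r₂`
with `r₁ = 0`). [folklore] -/
theorem nrComplexPlaces_eq_one (hK : IsImaginaryQuadratic K) : nrComplexPlaces K = 1 := by
  haveI := hK.2
  exact Literature.NumberTheory.QuadraticFields.Quadratic.nrComplexPlaces_eq_one hK.1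

/-- An imaginary quadratic field has exactly one infinite place. [folklore] -/
theorem card_infinitePlace_eq_one (hK : IsImaginaryQuadratic K) :
    Fintype.card (InfinitePlace K) = 1 := by
  rw [card_eq_nrRealPlaces_add_nrComplexPlaces, hK.nrRealPlaces_eq_zero,
    hK.nrComplexPlaces_eq_one]

/-- The discriminant of an imaginary quadratic field is negative: `sign d_K = (-1) ^ r₂`
(Mathlib `NumberField.sign_discr`) with `r₂ = 1`. This is the conjunct "`d_K < 0`" of the
printed definition of an imaginary quadratic field (Cox, *Primes of the form `x² + ny²`*,
2nd ed., p. 119). [folklore] -/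
theorem discr_neg (hK : IsImaginaryQuadratic K) : discr K < 0 := by
  have h := NumberField.sign_discr K
  rw [hK.nrComplexPlaces_eq_one, pow_one] at h
  exact Int.sign_eq_neg_one_iff_neg.mp h

/-- The unit rank `r₁ + r₂ - 1` of an imaginary quadratic field is `0`
(Mathlib `NumberField.Units.rank`). [folklore] -/
theorem unitsRank_eq_zero (hK : IsImaginaryQuadratic K) : Units.rank K = 0 := by
  rw [Units.rank, hK.card_infinitePlace_eq_one]

/-- Every unit of an imaginary quadratic field is a root of unity: by Dirichlet's unit theorem
(Mathlib `NumberField.Units.exist_unique_eq_mul_prod`) a unit is a root of unity times a product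
of fundamental units indexed by `Fin (rank K) = Fin 0`. Cox, *Primes of the form `x² + ny²`*,
p. 119 ("in the imaginary case, there are only finitely many units"). [folklore] -/
theorem mem_torsion (hK : IsImaginaryQuadratic K) (x : (𝓞 K)ˣ) : x ∈ Units.torsion K := by
  obtain ⟨⟨ζ, e⟩, hx, -⟩ := Units.exist_unique_eq_mul_prod K x
  haveI : IsEmpty (Fin (Units.rank K)) := by
    rw [hK.unitsRank_eq_zero]
    infer_instance
  rw [Finset.univ_eq_empty, Finset.prod_empty, mul_one] at hx
  rw [hx]
  exact ζ.2

/-- The unit group `𝓞_K^×` of an imaginary quadratic field is finite (it is its torsion subgroup,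
`mem_torsion`, which is finite: Mathlib `NumberField.Units.torsion`). Cox, *Primes of the form
`x² + ny²`*, p. 119. [folklore] -/
theorem finite_units (hK : IsImaginaryQuadratic K) : Finite (𝓞 K)ˣ :=
  Finite.of_surjective (fun z : Units.torsion K ↦ (z : (𝓞 K)ˣ))
    fun x ↦ ⟨⟨x, hK.mem_torsion x⟩, rfl⟩

/-- An imaginary quadratic field is a **CM field** in Mathlib's sense (`NumberField.IsCMField`:
a totally complex quadratic extension of its maximal totally real subfield, here `ℚ`), by
Mathlib's `IsCMField.ofCMExtension` applied to the CM-extension `K/ℚ`; this makes Mathlib's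
complex conjugation `NumberField.complexConj K` and the CM unit theory available under
`hK : IsImaginaryQuadratic K`. [folklore] -/
theorem isCMField (hK : IsImaginaryQuadratic K) : IsCMField K := by
  haveI := hK.2
  haveI : Algebra.IsQuadraticExtension ℚ K := { finrank_eq_two' := hK.1 }
  exact IsCMField.ofCMExtension ℚ K

/-- **Witness, quadratic-polynomial form.** A number field of degree `2` containing a root `θ` of
`X² + uX + v ∈ ℚ[X]` with `u² - 4v < 0` is imaginary quadratic (a real place would give a real
root; `Literature.NumberTheory.QuadraticFields.Quadratic.isTotallyComplex_of_quadratic`). [folklore] -/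
theorem of_quadratic (h2 : finrank ℚ K = 2) {θ : K} {u v : ℚ}
    (hrel : θ ^ 2 + algebraMap ℚ K u * θ + algebraMap ℚ K v = 0) (hneg : u ^ 2 - 4 * v < 0) :
    IsImaginaryQuadratic K :=
  ⟨h2, Literature.NumberTheory.QuadraticFields.Quadratic.isTotallyComplex_of_quadratic hrel hneg⟩

/-- **Witness, square-root form.** A number field of degree `2` containing a square root of a
negative rational `c` (`K = ℚ(√c)`, `c < 0`) is imaginary quadratic. [folklore] -/
theorem of_sq_eq (h2 : finrank ℚ K = 2) {θ : K} {c : ℚ} (hc : θ ^ 2 = algebraMap ℚ K c)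
    (hneg : c < 0) : IsImaginaryQuadratic K :=
  of_quadratic h2 (θ := θ) (u := 0) (v := -c) (by rw [hc, map_zero, map_neg]; ring) (by linarith)

/-- **Witness, cyclotomic form.** A cyclotomic field `ℚ(ζₙ)` with `2 < n` and `φ(n) = 2`
(i.e. `n ∈ {3, 4, 6}`) is imaginary quadratic: `[ℚ(ζₙ) : ℚ] = φ(n)`
(Mathlib `IsCyclotomicExtension.finrank`) and `ℚ(ζₙ)` has no real place for `n > 2`
(Mathlib `IsCyclotomicExtension.Rat.isTotallyComplex`). [folklore] -/
theorem of_isCyclotomicExtension {n : ℕ} [NeZero n] [IsCyclotomicExtension {n} ℚ K] (hn : 2 < n)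
    (hφ : n.totient = 2) : IsImaginaryQuadratic K :=
  ⟨by rw [IsCyclotomicExtension.finrank K (Polynomial.cyclotomic.irreducible_rat (NeZero.pos n)), hφ],
    IsCyclotomicExtension.Rat.isTotallyComplex K hn⟩

end IsImaginaryQuadratic

/-- The imaginary quadratic fields are exactly the CM fields (Mathlib `NumberField.IsCMField`) of
degree `2` over `ℚ`. [folklore] -/
theorem isImaginaryQuadratic_iff_isCMField :
    IsImaginaryQuadratic K ↔ finrank ℚ K = 2 ∧ IsCMField K :=
  ⟨fun hK ↦ ⟨hK.1, hK.isCMField⟩, fun h ↦ ⟨h.1, h.2.to_isTotallyComplex⟩⟩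

/-- **Agreement with the printed definition.** A number field `K` is imaginary quadratic in the
sense of `IsImaginaryQuadratic` (`[K : ℚ] = 2` and no real place) iff `[K : ℚ] = 2` and
`d_K < 0` (Cox, *Primes of the form `x² + ny²`*, 2nd ed., p. 119: "Quadratic fields come in two
flavors, real (`d_K > 0`) and imaginary (`d_K < 0`)"): by `sign d_K = (-1) ^ r₂`
(Mathlib `NumberField.sign_discr`) and `r₁ + 2r₂ = 2`
(Mathlib `NumberField.InfinitePlace.card_add_two_mul_card_eq_rank`), `d_K < 0` iff `r₂` is odd
iff `r₂ = 1` iff `r₁ = 0`. [folklore] -/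
theorem isImaginaryQuadratic_iff_discr_neg :
    IsImaginaryQuadratic K ↔ finrank ℚ K = 2 ∧ discr K < 0 := by
  refine ⟨fun hK ↦ ⟨hK.1, hK.discr_neg⟩, fun ⟨h2, hd⟩ ↦ ⟨h2, ?_⟩⟩
  rw [← nrRealPlaces_eq_zero_iff]
  have hsign := NumberField.sign_discr K
  rw [Int.sign_eq_neg_one_of_neg hd] at hsign
  have hodd : Odd (nrComplexPlaces K) := by
    by_contra h
    rw [Nat.not_odd_iff_even] at h
    rw [h.neg_one_pow] at hsign
    norm_num at hsign
  have hrk := card_add_two_mul_card_eq_rank K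
  rw [h2] at hrk
  obtain ⟨m, hm⟩ := hodd
  omega

/-- **The real/imaginary dichotomy of quadratic fields.** A quadratic field is either imaginary
quadratic or has positive discriminant (is real quadratic), and not both (Cox, p. 119; `d_K ≠ 0`
is Mathlib `NumberField.discr_ne_zero`). [folklore] -/
theorem isImaginaryQuadratic_xor_discr_pos (h2 : finrank ℚ K = 2) :
    Xor (IsImaginaryQuadratic K) (0 < discr K) := by
  rcases lt_or_lt_iff_ne.mpr (NumberField.discr_ne_zero K) with hd | hd
  · exact Or.inl ⟨isImaginaryQuadratic_iff_discr_neg.mpr ⟨h2, hd⟩, not_lt.mpr hd.le⟩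
  · exact Or.inr ⟨hd, fun hK ↦ absurd hK.discr_neg (not_lt.mpr hd.le)⟩

/-- `ℚ(ζ₃) = ℚ(√-3)` is imaginary quadratic. [folklore] -/
theorem isImaginaryQuadratic_of_isCyclotomicExtension_three [IsCyclotomicExtension {3} ℚ K] :
    IsImaginaryQuadratic K :=
  IsImaginaryQuadratic.of_isCyclotomicExtension (n := 3) (by norm_num) (by decide)

/-- `ℚ(ζ₄) = ℚ(i)` is imaginary quadratic. [folklore] -/
theorem isImaginaryQuadratic_of_isCyclotomicExtension_four [IsCyclotomicExtension {4} ℚ K] :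
    IsImaginaryQuadratic K :=
  IsImaginaryQuadratic.of_isCyclotomicExtension (n := 4) (by norm_num) (by decide)

/-- `ℚ(ζ₆) = ℚ(√-3)` is imaginary quadratic. [folklore] -/
theorem isImaginaryQuadratic_of_isCyclotomicExtension_six [IsCyclotomicExtension {6} ℚ K] :
    IsImaginaryQuadratic K :=
  IsImaginaryQuadratic.of_isCyclotomicExtension (n := 6) (by norm_num) (by decide)

end API

/-- **A concrete imaginary quadratic field**: Mathlib's model `CyclotomicField 3 ℚ` of
`ℚ(ζ₃) = ℚ(√-3)` satisfies `IsImaginaryQuadratic` (non-vacuity of the predicate). The predicate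
(through `NumberField`) refers to the canonical `ℚ`-algebra structure `DivisionRing.toRatAlgebra`,
whereas Mathlib's instance `CyclotomicField.isCyclotomicExtension` is stated for the splitting-field
algebra structure `CyclotomicField.algebra`; the two agree by `Subsingleton (Algebra ℚ _)`, and we
transport along that equality. [folklore] -/
theorem isImaginaryQuadratic_cyclotomicField_three : IsImaginaryQuadratic (CyclotomicField 3 ℚ) := by
  have h : (CyclotomicField.algebra 3 ℚ : Algebra ℚ (CyclotomicField 3 ℚ)) =
      DivisionRing.toRatAlgebra :=
    Subsingleton.elim _ _
  haveI : @IsCyclotomicExtension {3} ℚ (CyclotomicField 3 ℚ) _ _ DivisionRing.toRatAlgebra :=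
    h ▸ CyclotomicField.isCyclotomicExtension 3 ℚ
  exact isImaginaryQuadratic_of_isCyclotomicExtension_three

/-- **`ℚ` is not an imaginary quadratic field** (`[ℚ : ℚ] = 1 ≠ 2`). [folklore] -/
theorem not_isImaginaryQuadratic_rat : ¬ IsImaginaryQuadratic ℚ := by
  rintro ⟨h2, -⟩
  rw [Module.finrank_self] at h2
  exact absurd h2 (by norm_num)

/-- The universal closure of the predicate `IsImaginaryQuadratic` is false (witness `K = ℚ`):
`IsImaginaryQuadratic` is a definition to be *assumed* (`hK : IsImaginaryQuadratic K`), not a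
named fact admitting a discharge `IsImaginaryQuadratic_holds`. [folklore] -/
theorem not_forall_isImaginaryQuadratic :
    ¬ ∀ (K : Type) [Field K] [NumberField K], IsImaginaryQuadratic K :=
  fun h ↦ not_isImaginaryQuadratic_rat (h ℚ)

end Literature.NumberTheory.EllipticCurves

end
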